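import Summits.HodgeConjecture.HodgeConjecture.Theses.EndoscopicMiddleDegree
import Summits.HodgeConjecture.HodgeConjecture.Theorems.EndoscopicMiddleDegreeOrthogonalEnvelopedCorrAlgebra
import Summits.HodgeConjecture.HodgeConjecture.Theorems.EndoscopicMiddleDegreeIsotypicMiddleClassesAlgebraicStubIdempotentReduction
import Summits.HodgeConjecture.HodgeConjecture.Theorems.EndoscopicMiddleDegreeIsotypicMiddleClassesAlgebraicStubDetectionCriterion
import Summits.HodgeConjecture.HodgeConjecture.Theorems.IsotypicMiddleClassesAlgebraic.Negative.RationalFixed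
import Literature.AlgebraicGeometry.HodgeTheory.ComplexGysinCorrespondence
import Literature.AlgebraicGeometry.HodgeTheory.HodgeClassOfMorphismDuality
import Literature.AlgebraicGeometry.HodgeTheory.HodgeSectionRestrictionPairing
import Literature.AlgebraicGeometry.HodgeTheory.SupportedClassesRationalProofs
import HarnessLib

/-!
# Crux `IsotypicMiddleClassesAlgebraic` (stmt-HodgeConjecture-14301) is equivalent to a
# DETECTION statement: one non-vanishing cup product per class (line `virtual-lefschetz-noncongruence`,
# engine assembled)

Support file for the crux `EndoscopicMiddleDegree.IsotypicMiddleClassesAlgebraic` of the route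
`Summits/HodgeConjecture/HodgeConjecture/Theses/EndoscopicMiddleDegree` (lead
`prover-line-stmt-HodgeConjecture-14301-a3-0`, 2026-08-16). The crux says: for `μ` with Poincaré
duality, `m ∈ {1,2}`, a datum `D` on `X` (`dim X = 2n`, `n = m+1`) and an algebraic
`γ ∈ N^{2n}H^{4n}((X ⊗ X)(ℂ))` whose action `P = γ_* = pr₁₊(pr₂^* – ∪ γ)` preserves rational
classes (H2) and has purely `(n,n)` image (H3), every rational `P`-fixed class is algebraic.

WHAT IS PROVED. Write `DETECT` for: for every such `μ, m, X, D` and every ADMISSIBLE IDEMPOTENT `γ`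
(H2, H3, `P ∘ P = P`), every non-zero rational class `c'` which is cup-orthogonal to every
RATIONAL class of `ker P` has `c' ∪ a ≠ 0` in `H^{4n}(X(ℂ); ℂ)` for SOME algebraic
`a ∈ Nⁿ H^{2n}(X(ℂ))`.
* `isotypicMiddleClassesAlgebraic_of_detection` — **`CupProductAlgebraic → DETECT → crux`**: the
  engine of the line — Fitting reduction to idempotents (`stub_idempotentReduction`, landed
  p111625) fed with the composition closure of actions of algebraic classes
  (`exists_algebraic_corrAction_comp` + the route support `CupProductAlgebraic` on `X ⊗ (X ⊗ X)`),
  then the rank count over `ℚ` (`stub_detectionCriterion`, landed p111967).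
* `detection_of_isotypicMiddleClassesAlgebraic` — **`crux → DETECT`**: for rational `x`,
  `x - P x` is a rational class of `ker P`, so `c' ∪ x = c' ∪ P x` with `P x` rational and
  `P`-fixed, hence algebraic by the crux; if no algebraic class detected `c'`, then `c' ∪ x = 0` for
  all rational `x`, hence for all `x` (rational classes span,
  `span_isRationalClass_eq_top_of_isSmoothProjective_holds`), hence `c' = 0` by the perfectness of
  the cup pairing of the closed oriented manifold `X(ℂ)` (`isPerfPair_cupPairing_complexPoints`).
So, granted `CupProductAlgebraic` (Voisin II Prop. 9.20), the crux is EQUIVALENT to `DETECT`: the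
algebraicity problem for the pieces `Im P` is exactly the problem of producing, for each non-zero
rational class orthogonal to the rational kernel, ONE algebraic class with a non-zero period
against it. Any future SUPPLY of detecting algebraic classes (norms of divisor powers from covers
finite étale off special divisors — the line's open stub `stub_virtualLefschetzSupply`; Hecke
self-correlation strata; cycles on special divisors; …) closes the crux through
`isotypicMiddleClassesAlgebraic_of_detection` in one line.

## References
* [VoisinHodgeI2002] C. Voisin, Hodge Theory and Complex Algebraic Geometry I, CUP 2002, §7.1.1.
* [VoisinHodgeII2003] C. Voisin, Hodge Theory and Complex Algebraic Geometry II, CUP 2003, Prop. 9.20.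
* [Fulton1998] W. Fulton, Intersection Theory, 2nd ed., Springer 1998, §16.1.
* [HatcherAT2002] A. Hatcher, Algebraic Topology, CUP 2002, §3.3 Prop. 3.38.
-/

noncomputable section

-- `Summit.HodgeConjecture.HodgeConjecture.Theorems` is the mandated namespace (single-problem
-- summit: Problem = Summit), flagged by `linter.dupNamespace`; restated for stand-alone elaboration.
set_option linter.dupNamespace false

open CategoryTheory MonoidalCategory CartesianMonoidalCategory AlgebraicGeometry
open Literature.AlgebraicGeometry Literature.AlgebraicGeometry.HodgeTheory
open Literature.AlgebraicGeometry.Motives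
open Literature.AlgebraicGeometry.ShimuraVarieties Literature.AlgebraicTopology.SingularHomology
open Summit.HodgeConjecture.HodgeConjecture.Theses

namespace Summit.HodgeConjecture.HodgeConjecture.Theorems

/-- **The engine of line `virtual-lefschetz-noncongruence`: `CupProductAlgebraic → DETECT → crux`.**
Granted the route support `CupProductAlgebraic` (stmt-HodgeConjecture-14350): if for every
orientation family `μ` with Poincaré duality, `m ∈ {1,2}`, datum `D` on `X` and every algebraic
`γ` whose action `P` preserves rational classes, has purely `(n,n)` image and is IDEMPOTENT, every
non-zero rational class `c'` cup-orthogonal to all rational classes of `ker P` is detected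
(`c' ∪ a ≠ 0`) by some algebraic `a ∈ Nⁿ H^{2n}(X(ℂ))`, then `IsotypicMiddleClassesAlgebraic`
holds. Proof: reduce `γ` to an admissible idempotent fixing `c` (`stub_idempotentReduction`, fed
with `exists_algebraic_corrAction_comp` and `CupProductAlgebraic` on `X ⊗ (X ⊗ X)`), then apply
the rank count `stub_detectionCriterion`. [cite: VoisinHodgeI2002, §7.1.1]
[cite: Fulton1998, §16.1 Prop. 16.1.1] -/
theorem isotypicMiddleClassesAlgebraic_of_detection (h9 : EndoscopicMiddleDegree.CupProductAlgebraic)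
    (hdet : ∀ (μ : OrientationFamily), μ.HasPoincareDuality → ∀ (m : ℕ) (X : SchemeOver ℂ)
      (D : UnitaryBallQuotientDatum (2 * (m + 1)) X), 1 ≤ m → m ≤ 2 →
      ∀ γ ∈ algebraicClasses (X ⊗ X) (2 * (m + 1)),
      (∀ β, IsRationalClass β → IsRationalClass (corrAction μ D.isSmoothProjective
        D.isSmoothProjective
        (rfl : 2 * (m + 1) + 2 * (2 * (m + 1)) = 2 * (m + 1) + 2 * (2 * (m + 1))) γ β)) →
      (∀ β, IsOfHodgeType (2 * (m + 1)) X (2 * (m + 1)) (m + 1) (m + 1)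
        (corrAction μ D.isSmoothProjective D.isSmoothProjective
          (rfl : 2 * (m + 1) + 2 * (2 * (m + 1)) = 2 * (m + 1) + 2 * (2 * (m + 1))) γ β)) →
      (∀ β, corrAction μ D.isSmoothProjective D.isSmoothProjective
          (rfl : 2 * (m + 1) + 2 * (2 * (m + 1)) = 2 * (m + 1) + 2 * (2 * (m + 1))) γ
          (corrAction μ D.isSmoothProjective D.isSmoothProjective
            (rfl : 2 * (m + 1) + 2 * (2 * (m + 1)) = 2 * (m + 1) + 2 * (2 * (m + 1))) γ β) =
        corrAction μ D.isSmoothProjective D.isSmoothProjective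
          (rfl : 2 * (m + 1) + 2 * (2 * (m + 1)) = 2 * (m + 1) + 2 * (2 * (m + 1))) γ β) →
      ∀ c' : complexBetti X (2 * (m + 1)), IsRationalClass c' →
      (∀ x : complexBetti X (2 * (m + 1)), IsRationalClass x →
        corrAction μ D.isSmoothProjective D.isSmoothProjective
          (rfl : 2 * (m + 1) + 2 * (2 * (m + 1)) = 2 * (m + 1) + 2 * (2 * (m + 1))) γ x = 0 →
        cupProduct (two_mul_add_two_mul (m + 1) (m + 1)) c' x = 0) →
      c' ≠ 0 →
      ∃ a ∈ algebraicClasses X (m + 1), cupProduct (two_mul_add_two_mul (m + 1) (m + 1)) c' a ≠ 0) :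
    EndoscopicMiddleDegree.IsotypicMiddleClassesAlgebraic := by
  intro μ hμ m X D h1 h2 γ hγ P hPrat hPhdg c hc hPc
  have hX := D.isSmoothProjective
  have hXXX : IsSmoothProjective (2 * (m + 1) + (2 * (m + 1) + 2 * (m + 1))) (X ⊗ (X ⊗ X)) :=
    IsSmoothProjective.tensor_holds hX (IsSmoothProjective.tensor_holds hX hX)
  -- S1: actions of algebraic classes are closed under composition
  have hcomp : ∀ γ₁ ∈ algebraicClasses (X ⊗ X) (2 * (m + 1)),
      ∀ γ₂ ∈ algebraicClasses (X ⊗ X) (2 * (m + 1)),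
      ∃ γ₃ : complexBetti (X ⊗ X) (2 * (2 * (m + 1))),
        γ₃ ∈ algebraicClasses (X ⊗ X) (2 * (m + 1)) ∧
        ∀ β : complexBetti X (2 * (m + 1)),
          corrAction μ hX hX
              (rfl : 2 * (m + 1) + 2 * (2 * (m + 1)) = 2 * (m + 1) + 2 * (2 * (m + 1))) γ₃ β =
            corrAction μ hX hX
              (rfl : 2 * (m + 1) + 2 * (2 * (m + 1)) = 2 * (m + 1) + 2 * (2 * (m + 1))) γ₁
              (corrAction μ hX hX
                (rfl : 2 * (m + 1) + 2 * (2 * (m + 1)) = 2 * (m + 1) + 2 * (2 * (m + 1))) γ₂ β) := by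
    intro γ₁ hγ₁ γ₂ hγ₂
    obtain ⟨γ₃, hγ₃, h⟩ :=
      Cruxes.OrthogonalEnveloped.ImpureBarrenEnvelope.exists_algebraic_corrAction_comp hμ hX
        (fun a ha b hb ↦ h9 hXXX (2 * (m + 1)) (2 * (m + 1)) a b ha hb) (2 * (m + 1)) hγ₁ hγ₂
    exact ⟨γ₃, hγ₃, fun β ↦ LinearMap.congr_fun h β⟩
  -- S2: reduction to an admissible idempotent fixing `c`
  obtain ⟨γ', hγ', hP'rat, hP'hdg, hP'idem, hP'c⟩ :=
    stub_idempotentReduction μ hμ m X hX hcomp γ hγ hPrat hPhdg c hc hPc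
  -- S4: the rank count, fed with the detection hypothesis
  exact stub_detectionCriterion h9 μ hμ m X hX γ' hγ' hP'rat hP'idem
    (fun c' hc' hc'0 hc'K ↦ hdet μ hμ m X D h1 h2 γ' hγ' hP'rat hP'hdg hP'idem c' hc' hc'K hc'0)
    c hc hP'c

/-- **Conversely, `crux → DETECT`.** Under `IsotypicMiddleClassesAlgebraic`: for an admissible
idempotent `P` (H2, H3) and a non-zero rational `c'` cup-orthogonal to every rational class of
`ker P`, some algebraic class `a` has `c' ∪ a ≠ 0`. Indeed for rational `x` the class `x - P x` is
rational and in `ker P`, so `c' ∪ x = c' ∪ P x` with `P x` rational and `P`-fixed, hence algebraic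
by the crux; were `c'` undetected by algebraic classes, `c' ∪ x` would vanish for all rational
`x`, hence for all `x` (the rational classes span `H^{2n}(X(ℂ); ℂ)`,
`span_isRationalClass_eq_top_of_isSmoothProjective_holds`), forcing `c' = 0` by the perfectness of
the cup pairing on the closed oriented manifold `X(ℂ)` (`isPerfPair_cupPairing_complexPoints`).
Together with `isotypicMiddleClassesAlgebraic_of_detection`: granted `CupProductAlgebraic`, the crux
is EQUIVALENT to the detection statement. [cite: HatcherAT2002, §3.3 Prop. 3.38]
[cite: VoisinHodgeI2002, §7.1.1] -/
theorem detection_of_isotypicMiddleClassesAlgebraic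
    (h : EndoscopicMiddleDegree.IsotypicMiddleClassesAlgebraic)
    (μ : OrientationFamily) (hμ : μ.HasPoincareDuality) (m : ℕ) (X : SchemeOver ℂ)
    (D : UnitaryBallQuotientDatum (2 * (m + 1)) X) (h1 : 1 ≤ m) (h2 : m ≤ 2)
    (γ : complexBetti (X ⊗ X) (2 * (2 * (m + 1))))
    (hγ : γ ∈ algebraicClasses (X ⊗ X) (2 * (m + 1)))
    (hPrat : ∀ β, IsRationalClass β → IsRationalClass (corrAction μ D.isSmoothProjective
      D.isSmoothProjective (rfl : 2 * (m + 1) + 2 * (2 * (m + 1)) = 2 * (m + 1) + 2 * (2 * (m + 1))) γ β))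
    (hPhdg : ∀ β, IsOfHodgeType (2 * (m + 1)) X (2 * (m + 1)) (m + 1) (m + 1)
      (corrAction μ D.isSmoothProjective D.isSmoothProjective
        (rfl : 2 * (m + 1) + 2 * (2 * (m + 1)) = 2 * (m + 1) + 2 * (2 * (m + 1))) γ β))
    (hPidem : ∀ β, corrAction μ D.isSmoothProjective D.isSmoothProjective
        (rfl : 2 * (m + 1) + 2 * (2 * (m + 1)) = 2 * (m + 1) + 2 * (2 * (m + 1))) γ
        (corrAction μ D.isSmoothProjective D.isSmoothProjective
          (rfl : 2 * (m + 1) + 2 * (2 * (m + 1)) = 2 * (m + 1) + 2 * (2 * (m + 1))) γ β) =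
      corrAction μ D.isSmoothProjective D.isSmoothProjective
        (rfl : 2 * (m + 1) + 2 * (2 * (m + 1)) = 2 * (m + 1) + 2 * (2 * (m + 1))) γ β)
    (c' : complexBetti X (2 * (m + 1))) (hc' : IsRationalClass c')
    (hc'K : ∀ x : complexBetti X (2 * (m + 1)), IsRationalClass x →
      corrAction μ D.isSmoothProjective D.isSmoothProjective
        (rfl : 2 * (m + 1) + 2 * (2 * (m + 1)) = 2 * (m + 1) + 2 * (2 * (m + 1))) γ x = 0 →
      cupProduct (two_mul_add_two_mul (m + 1) (m + 1)) c' x = 0)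
    (hc'0 : c' ≠ 0) :
    ∃ a ∈ algebraicClasses X (m + 1), cupProduct (two_mul_add_two_mul (m + 1) (m + 1)) c' a ≠ 0 := by
  have _ := hc'
  set P : complexBetti X (2 * (m + 1)) →ₗ[ℂ] complexBetti X (2 * (m + 1)) :=
    corrAction μ D.isSmoothProjective D.isSmoothProjective
      (rfl : 2 * (m + 1) + 2 * (2 * (m + 1)) = 2 * (m + 1) + 2 * (2 * (m + 1))) γ with hPdef
  by_contra hall
  push Not at hall
  apply hc'0
  -- `c' ∪ x = 0` for every RATIONAL `x`: `x = (x - P x) + P x`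
  have hrat : ∀ x : complexBetti X (2 * (m + 1)), IsRationalClass x →
      cupProduct (two_mul_add_two_mul (m + 1) (m + 1)) c' x = 0 := by
    intro x hx
    have hPx : IsRationalClass (P x) := hPrat x hx
    have hPPx : P (P x) = P x := hPidem x
    have hker : P (x - P x) = 0 := by rw [map_sub, hPPx, sub_self]
    have h0 : cupProduct (two_mul_add_two_mul (m + 1) (m + 1)) c' (x - P x) = 0 :=
      hc'K _ (IsotypicMiddleClassesAlgebraic.Negative.RationalFixed.isRationalClass_sub hx hPx) hker
    have halg : P x ∈ algebraicClasses X (m + 1) :=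
      h μ hμ m X D h1 h2 γ hγ hPrat hPhdg (P x) hPx hPPx
    have h1' : cupProduct (two_mul_add_two_mul (m + 1) (m + 1)) c' (P x) = 0 := hall _ halg
    have hx' : x = (x - P x) + P x := by abel
    rw [hx', map_add, h0, h1', add_zero]
  -- hence for every `x` (the rational classes span)
  have hallx : ∀ x : complexBetti X (2 * (m + 1)),
      cupProduct (two_mul_add_two_mul (m + 1) (m + 1)) c' x = 0 := by
    intro x
    have hspan := span_isRationalClass_eq_top_of_isSmoothProjective_holds (2 * (m + 1)) X
      D.isSmoothProjective (2 * (m + 1))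
    have hx : x ∈ Submodule.span ℂ {x : complexBetti X (2 * (m + 1)) | IsRationalClass x} := by
      rw [hspan]; exact Submodule.mem_top
    exact LinearMap.mem_ker.1 ((Submodule.span_le (p := LinearMap.ker
      (cupProduct (two_mul_add_two_mul (m + 1) (m + 1)) c'))).2
      (fun y hy ↦ LinearMap.mem_ker.2 (hrat y hy)) hx)
  -- hence `c' = 0` by the perfect cup pairing of `X(ℂ)`
  have had : 2 * (m + 1) + 2 * (m + 1) = 2 * (2 * (m + 1)) := by ring
  have hperf := isPerfPair_cupPairing_complexPoints μ D.isSmoothProjective had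
  haveI := hperf
  apply (LinearMap.IsPerfPair.bijective_left (cupPairing (μ D.isSmoothProjective) had)).1
  rw [map_zero]
  refine LinearMap.ext fun x ↦ ?_
  rw [cupPairing_apply, LinearMap.zero_apply,
    (cupProduct_eq_zero_iff_of_degree_eq had (two_mul_add_two_mul (m + 1) (m + 1)) c' x).2
      (hallx x), map_zero, LinearMap.zero_apply]

end Summit.HodgeConjecture.HodgeConjecture.Theorems

end
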